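import Summits.ValiantsHypothesis.ValiantsHypothesis.Theorems.KPlusLogSqLawValuativeDoorSquaring

/-!
# LINE `valuative_door` (crux `WeakLifting`, stmt-ValiantsHypothesis-19561) — the support stub `SymmetryVoid`
# (`∀ m K B, ValRootLawAt (2m) K B → GenValRootLawAt m K B`) of `Cruxes/WeakLifting/Lines/valuative_door.lean` (rev 2 @84c5f76c6d22),
# PROVED in its unfolded form

HONEST FRAMING.  Helper (cell `pub-symmetroid`, seat val-sym-lift-p1 g21, 2026-08-29; `--supports 19561 --as helper`).  «Symmetry is void
up to `m ↦ 2m`» (crit-6 VERDICT #54 (a2)): a general `m × m` lacunary pencil `P = Σ_l X^{d l} M_l` embeds into the SYMMETRIC `2m × 2m`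
pencil with letters `S_l = reindex (fromBlocks 0 M_l M_lᵀ 0)`, whose determinant is `C c · (det P)²` with `c = det (fromBlocks 0 1 1 0)
≠ 0`; by `…ValuativeDoorSquaring` (non-archimedean `v`) the dominant-exponent count of `det P` is at most that of `C c · (det P)²`, so a
valuative census bound for symmetric `(2m, K)` pencils bounds general `(m, K)` pencils.  The theorem below is the skeleton's
`SymmetryVoid` with `ValRootLawAt`, `GenValRootLawAt`, `npEdges`, `domCount` UNFOLDED binder for binder (the line file gets
`stub_symmetryVoid` by `exact`).  A support stub of the line (tag S, «expected routine») — it is NOT the crux, closes nothing on the ledger by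
itself, and bears on neither vW / vB / `ValRankOneLaw`, `TropicalB`, `MatrixDescartes` (18050) nor VP ≠ VNP.  [elementary]
-/

set_option linter.dupNamespace false
set_option autoImplicit false

namespace Summit.ValiantsHypothesis.ValiantsHypothesis.Theorems.KPlusLogSqLaw.ValDoor

open Polynomial Finset Matrix
open scoped BigOperators Classical

/-- **determinant of the anti-block-diagonal symmetric double**: `det (fromBlocks 0 P Pᵀ 0) = C c · (det P)²` for the nonzero constant
`c = det (fromBlocks 0 1 1 0 : Matrix _ _ F)`. [bookkeeping: `fromBlocks P 0 0 Pᵀ * J`, `det_fromBlocks_zero₂₁`, `J² = 1`] -/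
theorem det_fromBlocks_double {F : Type*} [Field F] {m : ℕ} (P : Matrix (Fin m) (Fin m) F[X]) :
    ∃ c : F, c ≠ 0 ∧ (Matrix.fromBlocks 0 P Pᵀ 0).det = C c * P.det ^ 2 := by
  have hJJ : (Matrix.fromBlocks 0 1 1 0 : Matrix (Fin m ⊕ Fin m) (Fin m ⊕ Fin m) F)
      * Matrix.fromBlocks 0 1 1 0 = 1 := by
    rw [Matrix.fromBlocks_multiply]
    simp [Matrix.fromBlocks_one]
  have hdetJ : (Matrix.fromBlocks 0 1 1 0 : Matrix (Fin m ⊕ Fin m) (Fin m ⊕ Fin m) F).det ≠ 0 := by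
    intro h0
    have h1 := congrArg Matrix.det hJJ
    rw [Matrix.det_mul, h0, zero_mul, Matrix.det_one] at h1
    exact zero_ne_one h1
  refine ⟨_, hdetJ, ?_⟩
  have hfac : Matrix.fromBlocks 0 P Pᵀ 0
      = Matrix.fromBlocks P 0 0 Pᵀ * (Matrix.fromBlocks 0 1 1 0 : Matrix (Fin m ⊕ Fin m) (Fin m ⊕ Fin m) F).map (C : F →+* F[X]) := by
    rw [Matrix.fromBlocks_map, Matrix.map_one _ (map_zero C) (map_one C), Matrix.map_zero _ (map_zero C), Matrix.fromBlocks_multiply]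
    simp
  rw [hfac, Matrix.det_mul, Matrix.det_fromBlocks_zero₂₁, Matrix.det_transpose, ← RingHom.mapMatrix_apply, ← RingHom.map_det]
  ring

/-- **`SymmetryVoid` UNFOLDED — symmetry is void up to `m ↦ 2m`:** a valuative census bound `B` for SYMMETRIC lacunary pencils of format
`(2m, K)` (over every non-archimedean valued field of characteristic zero) bounds GENERAL lacunary pencils of format `(m, K)`.
[elementary: symmetric double `reindex (fromBlocks 0 M Mᵀ 0)`, `det = C c · (det P)²`, and `card_dominant_le_card_dominant_C_mul_sq`] -/
theorem symmetryVoid_unfolded : ∀ m K B : ℕ,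
    (∀ (F : Type) [Field F] [CharZero F] (v : AbsoluteValue F ℝ), IsNonarchimedean v →
      ∀ (d : Fin K → ℕ) (S : Fin K → Matrix (Fin (2 * m)) (Fin (2 * m)) F), (∀ l, (S l).IsSymm) →
        ((Matrix.det (∑ l, ((Polynomial.X : Polynomial F) ^ d l) • (S l).map Polynomial.C)).support.filter fun E =>
            ∃ r : ℝ, 0 < r ∧ ∀ E' ∈ (Matrix.det (∑ l, ((Polynomial.X : Polynomial F) ^ d l) • (S l).map Polynomial.C)).support,
              E' ≠ E →
              v ((Matrix.det (∑ l, ((Polynomial.X : Polynomial F) ^ d l) • (S l).map Polynomial.C)).coeff E') * r ^ E'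
                < v ((Matrix.det (∑ l, ((Polynomial.X : Polynomial F) ^ d l) • (S l).map Polynomial.C)).coeff E) * r ^ E).card - 1
          ≤ B) →
    ∀ (F : Type) [Field F] [CharZero F] (v : AbsoluteValue F ℝ), IsNonarchimedean v →
      ∀ (d : Fin K → ℕ) (M : Fin K → Matrix (Fin m) (Fin m) F),
        ((Matrix.det (∑ l, ((Polynomial.X : Polynomial F) ^ d l) • (M l).map Polynomial.C)).support.filter fun E =>
            ∃ r : ℝ, 0 < r ∧ ∀ E' ∈ (Matrix.det (∑ l, ((Polynomial.X : Polynomial F) ^ d l) • (M l).map Polynomial.C)).support,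
              E' ≠ E →
              v ((Matrix.det (∑ l, ((Polynomial.X : Polynomial F) ^ d l) • (M l).map Polynomial.C)).coeff E') * r ^ E'
                < v ((Matrix.det (∑ l, ((Polynomial.X : Polynomial F) ^ d l) • (M l).map Polynomial.C)).coeff E) * r ^ E).card - 1
          ≤ B := by
  intro m K B h F _ _ v hv d M
  -- the symmetric double, reindexed to `Fin (2m)`
  obtain ⟨e⟩ : Nonempty (Fin m ⊕ Fin m ≃ Fin (2 * m)) := ⟨finSumFinEquiv.trans (finCongr (two_mul m).symm)⟩
  have hsymm : ∀ l, (Matrix.reindex e e (Matrix.fromBlocks 0 (M l) (M l)ᵀ 0)).IsSymm := by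
    intro l
    rw [Matrix.reindex_apply]
    exact (Matrix.IsSymm.fromBlocks Matrix.isSymm_zero rfl Matrix.isSymm_zero).submatrix _
  have hS := h F v hv d (fun l => Matrix.reindex e e (Matrix.fromBlocks 0 (M l) (M l)ᵀ 0)) hsymm
  -- identify the symmetric pencil with the reindexed double of the general pencil
  have hpencil : (∑ l, (X : F[X]) ^ d l • (Matrix.reindex e e (Matrix.fromBlocks 0 (M l) (M l)ᵀ 0)).map (C : F →+* F[X]))
      = Matrix.reindex e e (Matrix.fromBlocks 0 (∑ l, (X : F[X]) ^ d l • (M l).map (C : F →+* F[X]))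
          (∑ l, (X : F[X]) ^ d l • (M l).map (C : F →+* F[X]))ᵀ 0) := by
    ext i j
    simp only [Matrix.reindex_apply, Matrix.submatrix_apply, Matrix.sum_apply, Matrix.smul_apply, Matrix.map_apply, smul_eq_mul]
    rcases e.symm i with a | a <;> rcases e.symm j with b | b <;>
      simp [Matrix.sum_apply, Matrix.smul_apply, Matrix.map_apply, Matrix.transpose_apply, smul_eq_mul]
  obtain ⟨c, hc, hdet⟩ := det_fromBlocks_double (∑ l, (X : F[X]) ^ d l • (M l).map (C : F →+* F[X]))
  have hdet' : Matrix.det (∑ l, (X : F[X]) ^ d l • (Matrix.reindex e e (Matrix.fromBlocks 0 (M l) (M l)ᵀ 0)).map (C : F →+* F[X]))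
      = C c * (Matrix.det (∑ l, (X : F[X]) ^ d l • (M l).map (C : F →+* F[X]))) ^ 2 := by
    rw [hpencil, Matrix.det_reindex_self, hdet]
  simp only [hdet'] at hS
  exact le_trans (Nat.sub_le_sub_right
    (card_dominant_le_card_dominant_C_mul_sq v hv (Matrix.det (∑ l, (X : F[X]) ^ d l • (M l).map (C : F →+* F[X]))) hc) 1) hS

end Summit.ValiantsHypothesis.ValiantsHypothesis.Theorems.KPlusLogSqLaw.ValDoor
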